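import Summits.HodgeConjecture.HodgeConjecture.Theorems.Ring2WeilCoverageCMFieldCarrierInstances
import HarnessLib

/-!
# Ring 2 — Weil-type family-coverage census, CM-field rows (X-U): the `g = 12` rows `(3,2)` — CM fields of degree
# `2ℓ`, `ℓ` an ODD PRIME (every SEXTIC CM field, Galois or not): on EVERY δ-row and every `E`-rank a CM member at
# which the Hodge conjecture holds in the kernel; cubic Deligne carriers; roots of `R` from a root of unity in `E`

HONEST FRAMING: research route conditional on HC_CM; not a corollary; Q11.4-sentence-2 already refuted in dim ≥ 3.

Cell `pub-hodge-ring2`, seat `ring2-b03` (gen 58), census `WEIL-FAMILY-COVERAGE.md` «## b03», open cell (iv′) (the `g = 12`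
index rows of b03.8): the rows `(e₀, k) = (3, 2)` — `E` a SEXTIC CM field over a totally real cubic field `F`, `A` of
dimension `12 = 2·e₀·k` with `E ↪ End⁰(A)` of Weil signature `(2,2;2,2;2,2)`, `W_E = ⋀⁴_E H¹(A,ℚ) ⊂ H⁴(A,ℚ)` of codimension
`2`, rows `W12.E.δ` indexed by `δ ∈ F^×/Nm_{E/F}(E^×) = cmNormResidueGroup R` (Deligne, LNM 900 §4 (1), Cor. 4.2).

* §1 (generic, any carrier `R`): `fact_irreducible_realPolyQ_of_cmPolyQ` (`R(T²)` irreducible ⟹ `R` irreducible, as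
  `Fact`s); **`roots_real_neg_of_pow_eq_one`** — if `E = ℚ[T]/(R(T²))` contains `u` with `uⁿ = 1` (`n ≥ 1`) and
  `η = u − uⁿ⁻¹` (`= ζ − ζ⁻¹`), and `R(0) ≠ 0`, then every complex root `s` of `R` is REAL and NEGATIVE: along the
  embedding `τ : E → ℂ`, `η ↦ t`, `t² = s`, the image `z = τ(u)` lies on the unit circle, so `t = z − z̄ = 2i·Im z` and
  `s = t² = −4 (Im z)² < 0` (the hypothesis `hroots` of Deligne's presentation for every CYCLOTOMIC carrier, without
  locating roots); the CUBIC carriers `R = S³ + aS² + bS + c`: `realPolyQ_eq_of_cubic`, `cmPolyQ_eq_of_cubic`,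
  `eval₂_cmPolyQ_of_cubic`, `cmRoot_sextic` (`η⁶ + aη⁴ + bη² + c = 0`), `monic_and_natDegree_of_cubic`, `coeff_zero_of_cubic`.
* §2 **`exists_cmMember_hodgeConjectureFor_of_not_isGalois_of_prime`** — for every NON-GALOIS CM field `K` with
  `[K:ℚ] = 2ℓ`, `ℓ` prime, Deligne's presentation `(b₀, R)`, every `p ≥ 1` and EVERY `δ ∈ cmNormResidueGroup R`: a CM
  abelian variety with a Weil-type datum of `E`-rank `2p`, a Rosati-compatible polarization class of discriminant
  `δ`, the Hodge conjecture for it (kernel, unconditional) and `W_E ⊗ ℂ ⊂ H^{2p}` algebraic — a primitive type exists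
  (`PrimitiveCMTypeNonGalois.exists_isPrimitive_of_not_isGalois`, Shimura §8.4), is nondegenerate (Yanai,
  `isNondegenerate_of_isPrimitive_of_prime`), so part X-G (`exists_cmMember_hodgeConjectureFor_of_exists_isNondegenerate`)
  applies; the Galois twin is part X-C's `exists_cmMember_hodgeConjectureFor_of_finrank_eq_two_mul_prime` (`ℓ` odd).
  **`carrier_exists_cmMember_hodgeConjectureFor_of_prime`** — the two cases joined on the table's own carrier
  `cmField R`, `R` monic of ODD PRIME degree `ℓ` with `R(T²)` irreducible and real negative roots, GALOIS OR NOT: on EVERY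
  δ-row and every `E`-rank a CM member with HC in the kernel. Hence EVERY SEXTIC CM field (`ℓ = 3`: the `(3,2)` rows at
  `g = 12`, and `g = 12p` in general) and every CM field of degree `10, 14, 22, …`. The named sextic carriers `ℚ(ζ₇)`
  (`R = S³ + 7S² + 14S + 7`) and `ℚ(ζ₉)` (`R = S³ + 6S² + 9S + 3`) follow in part X-V.

THEOREMS ONLY: no `def`, no named fact, no `sorry`; `HC_CM` does not occur. HONEST COLUMN: named CM members only; the
sign of `δ` is not recorded by `IsPolarizationClass` (parts X-D/X-H/X-I, uniform in the degree: polarized members iff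
`(−1)^p δ ≫ 0`); nothing at the general member of any row (deciding input = transport, crux stmt-1076).

## References
* [Deligne1982HodgeCycles] P. Deligne (notes by J. S. Milne), *Hodge cycles on abelian varieties*, LNM 900 (1982), §4
  p. 30 (1), Cor. 4.2, §5 (c) pp. 38–39.
* [Schmidt1984CMArithmetik] C.-G. Schmidt, LNM 1082 (1984), Kap. II Satz 1.6 (Schappacher). [Yanai1985] H. Yanai, Nagoya
  Math. J. 97 (1985), §4 Theorem. [Pohlmann1968] H. Pohlmann, Ann. of Math. 88 (1968), Thm. 1.
* [Shimura1998] G. Shimura, *Abelian Varieties with Complex Multiplication and Modular Functions* (1998), §8.2 Prop. 26,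
  §8.4 (primitive types of non-Galois fields).
* [Washington1997] L. C. Washington, *Introduction to Cyclotomic Fields*, GTM 83, Ch. 2 (`η = ζ − ζ⁻¹`, `|ζ| = 1`).
-/

noncomputable section

set_option linter.dupNamespace false

namespace Summit.HodgeConjecture.HodgeConjecture.Ring2.WeilCoverageCM

open CategoryTheory CategoryTheory.Limits Polynomial NumberField
open scoped ComplexConjugate
open Literature.AlgebraicGeometry Literature.AlgebraicGeometry.Motives Literature.AlgebraicGeometry.HodgeTheory
open Literature.AlgebraicGeometry.ComplexMultiplication Literature.AlgebraicGeometry.Deligne1982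
open Literature.AlgebraicGeometry.Milne1999
open Summit.HodgeConjecture.HodgeConjecture.Ring2.Hypotheses (RosatiCompatible)
open Literature.AlgebraicGeometry.Pohlmann1968 (IsNondegenerate isNondegenerate_of_isPrimitive_of_prime)
open Literature.NumberTheory.ComplexMultiplication (PrimitiveCMTypeNonGalois.exists_isPrimitive_of_not_isGalois)

/-! ## §1 Generic carrier lemmas -/

section Generic

variable (R : Polynomial ℤ)

/-- `R(T²)` irreducible over `ℚ` ⟹ `R` irreducible over `ℚ` — the `Fact` making `F = realField R` a field, from the
one making `E = cmField R` a field (`irreducible_of_irreducible_comp_X_sq`). [folklore] -/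
theorem fact_irreducible_realPolyQ_of_cmPolyQ [h : Fact (Irreducible (cmPolyQ R))] :
    Fact (Irreducible (realPolyQ R)) :=
  ⟨irreducible_of_irreducible_comp_X_sq (by rw [← cmPolyQ_eq_comp]; exact h.out)⟩

/-- **Roots of `R` from a root of unity in `E`.** If `E = ℚ[T]/(R(T²))` contains `u` with `uⁿ = 1`, `n ≥ 1`,
`η = u − uⁿ⁻¹` (`= ζ − ζ⁻¹`) and `R(0) ≠ 0`, then every complex root of `R` is real and negative: for a root `s`,
choose `t ∈ ℂ` with `t² = s` and the embedding `τ : E → ℂ`, `η ↦ t`; `z = τ(u)` has `zⁿ = 1`, so `|z| = 1`,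
`zⁿ⁻¹ = z⁻¹ = z̄`, `t = z − z̄ = 2i Im z`, `s = t² = −4 (Im z)²`, and `s ≠ 0` as `R(0) ≠ 0`.
[cite: Washington1997, Ch. 2] [cite: Deligne1982HodgeCycles, §4 p. 30] -/
theorem roots_real_neg_of_pow_eq_one [Fact (Irreducible (cmPolyQ R))] {n : ℕ} (hn : 0 < n) {u : cmField R}
    (hu : u ^ n = 1) (hη : cmRoot R = u - u ^ (n - 1)) (hR0 : R.coeff 0 ≠ 0) :
    ∀ s : ℂ, Polynomial.eval₂ (Int.castRingHom ℂ) s R = 0 → s.im = 0 ∧ s.re < 0 := by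
  intro s hs
  obtain ⟨t, ht⟩ := IsAlgClosed.exists_eq_mul_self s
  have hroot : Polynomial.eval₂ (algebraMap ℚ ℂ) t (cmPolyQ R) = 0 := by
    show Polynomial.eval₂ (algebraMap ℚ ℂ) t ((R.comp (X ^ 2)).map (Int.castRingHom ℚ)) = 0
    rw [Polynomial.eval₂_map, RingHom.eq_intCast' ((algebraMap ℚ ℂ).comp (Int.castRingHom ℚ)),
      eval₂_comp_X_sq, sq, ← ht]
    exact hs
  let τ : cmField R →+* ℂ := AdjoinRoot.lift (algebraMap ℚ ℂ) t hroot
  have hτ : τ (cmRoot R) = t := AdjoinRoot.lift_root hroot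
  -- `z = τ(u)` lies on the unit circle
  set z : ℂ := τ u with hzdef
  have hzn : z ^ n = 1 := by rw [hzdef, ← map_pow, hu, map_one]
  have hnorm : ‖z‖ = 1 := Complex.norm_eq_one_of_pow_eq_one hzn hn.ne'
  have hzinv : z ^ (n - 1) = conj z := by
    rw [← Complex.inv_eq_conj hnorm]
    exact eq_inv_of_mul_eq_one_left (by rw [pow_sub_one_mul hn.ne', hzn])
  -- `t = z − z̄` is purely imaginary
  have htz : t = z - conj z := by
    rw [← hτ, hη, map_sub, map_pow, ← hzdef, hzinv]
  have htre : t.re = 0 := by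
    rw [htz, Complex.sub_re, Complex.conj_re, sub_self]
  -- `s ≠ 0` since `R(0) ≠ 0`, so `t ≠ 0`
  have hs0 : s ≠ 0 := by
    rintro rfl
    rw [Polynomial.eval₂_at_zero, eq_intCast, Int.cast_eq_zero] at hs
    exact hR0 hs
  have htim : t.im ≠ 0 := by
    intro h0
    apply hs0
    have h00 : t = 0 := Complex.ext (by rw [htre, Complex.zero_re]) (by rw [h0, Complex.zero_im])
    rw [ht, h00, mul_zero]
  refine ⟨?_, ?_⟩
  · rw [ht, Complex.mul_im, htre, zero_mul, mul_zero, add_zero]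
  · rw [ht, Complex.mul_re, htre, mul_zero, zero_sub, neg_lt_zero]
    exact mul_self_pos.2 htim

end Generic

/-! ### The cubic carriers `R = S³ + aS² + bS + c` (`E` sextic, `F` totally real cubic) -/

section Cubic

variable {a b c : ℤ} (R : Polynomial ℤ) (hR : R = X ^ 3 + C a * X ^ 2 + C b * X + C c)
include hR

/-- `realPolyQ R = S³ + aS² + bS + c ∈ ℚ[S]`. [cite: Deligne1982HodgeCycles, §4 p. 30] -/
theorem realPolyQ_eq_of_cubic : realPolyQ R = X ^ 3 + C (a : ℚ) * X ^ 2 + C (b : ℚ) * X + C (c : ℚ) := by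
  subst hR
  show Polynomial.map (Int.castRingHom ℚ) (X ^ 3 + C a * X ^ 2 + C b * X + C c) = _
  rw [Polynomial.map_add, Polynomial.map_add, Polynomial.map_add, Polynomial.map_mul, Polynomial.map_mul,
    Polynomial.map_pow, Polynomial.map_pow, map_X, map_C, map_C, map_C, eq_intCast, eq_intCast, eq_intCast]

/-- `cmPolyQ R = T⁶ + aT⁴ + bT² + c ∈ ℚ[T]`. [cite: Deligne1982HodgeCycles, §4 p. 30] -/
theorem cmPolyQ_eq_of_cubic : cmPolyQ R = X ^ 6 + C (a : ℚ) * X ^ 4 + C (b : ℚ) * X ^ 2 + C (c : ℚ) := by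
  rw [cmPolyQ_eq_comp, realPolyQ_eq_of_cubic R hR]
  simp only [add_comp, mul_comp, pow_comp, X_comp, C_comp]
  ring

/-- `R(T²) ⊗ S = T⁶ + aT⁴ + bT² + c` under any `ℚ → S`. [cite: Deligne1982HodgeCycles, §4 p. 30] -/
theorem map_cmPolyQ_of_cubic {S : Type*} [CommRing S] (f : ℚ →+* S) :
    (cmPolyQ R).map f = X ^ 6 + C (a : S) * X ^ 4 + C (b : S) * X ^ 2 + C (c : S) := by
  rw [cmPolyQ_eq_of_cubic R hR, Polynomial.map_add, Polynomial.map_add, Polynomial.map_add, Polynomial.map_mul,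
    Polynomial.map_mul, Polynomial.map_pow, Polynomial.map_pow, Polynomial.map_pow, map_X, map_C, map_C, map_C,
    map_intCast f a, map_intCast f b, map_intCast f c]

/-- `R(T²)(x) = x⁶ + ax⁴ + bx² + c` under any `ℚ → S`. [cite: Deligne1982HodgeCycles, §4 p. 30] -/
theorem eval₂_cmPolyQ_of_cubic {S : Type*} [CommRing S] (f : ℚ →+* S) (x : S) :
    Polynomial.eval₂ f x (cmPolyQ R) = x ^ 6 + (a : S) * x ^ 4 + (b : S) * x ^ 2 + (c : S) := by
  rw [← Polynomial.eval_map, map_cmPolyQ_of_cubic R hR]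
  simp only [eval_add, eval_mul, eval_pow, eval_X, eval_C]

/-- **`η⁶ + aη⁴ + bη² + c = 0`** in `E = ℚ[T]/(T⁶ + aT⁴ + bT² + c)`. [cite: Deligne1982HodgeCycles, §4 p. 30] -/
theorem cmRoot_sextic [Fact (Irreducible (cmPolyQ R))] :
    cmRoot R ^ 6 + (a : cmField R) * cmRoot R ^ 4 + (b : cmField R) * cmRoot R ^ 2 + (c : cmField R) = 0 := by
  rw [← eval₂_cmPolyQ_of_cubic R hR (AdjoinRoot.of (cmPolyQ R))]
  exact AdjoinRoot.eval₂_root _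

/-- `R = S³ + aS² + bS + c` is monic of degree `3`. [folklore] -/
theorem monic_and_natDegree_of_cubic : R.Monic ∧ R.natDegree = 3 := by
  subst hR
  exact ⟨by monicity!, by compute_degree!⟩

/-- `R(0) = c`. [folklore] -/
theorem coeff_zero_of_cubic : R.coeff 0 = c := by
  subst hR
  simp

end Cubic

/-! ## §2 CM fields of degree `2ℓ`, `ℓ` prime: the NON-GALOIS case (the Galois case is part X-C) -/

section OddPrime

variable (K : Type) [Field K] [NumberField K] [IsCMField K]

/-- **Every NON-GALOIS CM field of degree `2ℓ`, `ℓ` prime — in particular every non-Galois SEXTIC CM field:** for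
Deligne's presentation `(b₀, R)` of `K`, every `p ≥ 1` and EVERY `δ ∈ cmNormResidueGroup R`, the δ-cell `(E, 2p, δ)`
contains a CM abelian variety with a Weil-type datum of `E`-rank `2p`, a Rosati-compatible polarization class of
discriminant `δ`, at which the Hodge conjecture HOLDS (kernel: a primitive CM type exists for a non-Galois CM field —
Shimura §8.4, `PrimitiveCMTypeNonGalois.exists_isPrimitive_of_not_isGalois` —, is nondegenerate — Yanai, prime
half-degree —, and `Hdg = Div` on the powers of its realisation — Pohlmann, part X-G) and all of `W_E ⊗ ℂ ⊂ H^{2p}` is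
algebraic. (The Galois case, `ℓ` odd, is part X-C `exists_cmMember_hodgeConjectureFor_of_finrank_eq_two_mul_prime`;
for `ℓ = 2` this is part X-G's `D₄` theorem at every rank.) [cite: Shimura1998, §8.4] [cite: Yanai1985, §4 Theorem]
[cite: Pohlmann1968, Thm. 1] [cite: Deligne1982HodgeCycles, §5 (c) pp. 38–39] -/
theorem exists_cmMember_hodgeConjectureFor_of_not_isGalois_of_prime (hG : ¬ IsGalois ℚ K) {ℓ : ℕ} (hℓ : ℓ.Prime)
    (hKℓ : Module.finrank ℚ K = 2 * ℓ)
    {b₀ : 𝓞 K} (hb₀ : IsCMField.complexConj K (b₀ : K) = -(b₀ : K))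
    (hsep : Function.Injective fun σ : K →+* ℂ => σ (b₀ : K))
    {R : Polynomial ℤ} {e₀ : ℕ} (he : Module.finrank ℚ K = 2 * e₀) (hRm : R.Monic) (hRdeg : R.natDegree = e₀)
    (hR : R.comp (X ^ 2) = minpoly ℤ b₀) (hirr : Irreducible (cmPolyQ R))
    (hroots : ∀ s : ℂ, Polynomial.eval₂ (Int.castRingHom ℂ) s R = 0 → s.im = 0 ∧ s.re < 0)
    (haev : Polynomial.aeval (b₀ : K) (cmPolyQ R) = 0) (hdegQ : (cmPolyQ R).natDegree = Module.finrank ℚ K)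
    [Fact (Irreducible (realPolyQ R))] {p : ℕ} (hp : 0 < p) (δ : cmNormResidueGroup R) :
    ∃ (A : AbelianVariety ℂ) (η : A ⟶ A) (h : complexBetti A.X 2),
      IsOfCMType A ∧ IsWeilTypeCM A η R e₀ p ∧ IsPolarizationClass A.dim A.X h ∧ RosatiCompatible A η h ∧
      HasWeilDiscriminantCM A η R e₀ p h δ ∧ HodgeConjectureFor A.dim A.X ∧
      weilClassesField A η (R.comp (X ^ 2)) (2 * p) ≤ algebraicClasses A.X p := by
  obtain ⟨Θ, hΘ⟩ := PrimitiveCMTypeNonGalois.exists_isPrimitive_of_not_isGalois (K := K) hG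
  obtain ⟨φ₀⟩ : Nonempty (K →+* ℂ) := inferInstance
  have hnd : IsNondegenerate Θ := isNondegenerate_of_isPrimitive_of_prime hℓ hKℓ φ₀ (hΘ φ₀)
  have h2 : 2 < Module.finrank ℚ K := by
    rw [hKℓ]
    have := hℓ.two_le
    omega
  exact exists_cmMember_hodgeConjectureFor_of_exists_isNondegenerate K h2 hb₀ hsep he hRm hRdeg hR hirr hroots haev
    hdegQ ⟨Θ, hnd⟩ hp δ

end OddPrime

/-! ### On the carrier: `R` monic of odd prime degree -/

section Carrier

variable (R : Polynomial ℤ) [Fact (Irreducible (cmPolyQ R))] [Fact (Irreducible (realPolyQ R))]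

/-- **The rows `(ℓ, p)` on the carrier, `ℓ` an odd prime: HC at a CM member on EVERY row.** For `R ∈ ℤ[S]` monic of
odd prime degree `ℓ` with `R(T²)` irreducible over `ℚ` and all roots of `R` real negative (`E = cmField R` a CM
field of degree `2ℓ`, GALOIS OR NOT — part X-C in the Galois case, §2 above otherwise), every `p ≥ 1` and EVERY `δ ∈ cmNormResidueGroup R`: a CM abelian variety of
dimension `2ℓp` with a Weil-type datum `IsWeilTypeCM A η R ℓ p`, a Rosati-compatible polarization class of
discriminant `δ`, the Hodge conjecture for it (kernel) and `W_E ⊗ ℂ ⊂ H^{2p}` algebraic — for `ℓ = 3`, `p = 2` the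
`g = 12` rows `W12.E.δ` of the census. [cite: Yanai1985, §4 Theorem] [cite: Pohlmann1968, Thm. 1]
[cite: Deligne1982HodgeCycles, §5 (c) pp. 38–39] -/
theorem carrier_exists_cmMember_hodgeConjectureFor_of_prime (hRm : R.Monic) {ℓ : ℕ} (hℓ : ℓ.Prime) (hℓ2 : ℓ ≠ 2)
    (hRdeg : R.natDegree = ℓ)
    (hroots : ∀ s : ℂ, Polynomial.eval₂ (Int.castRingHom ℂ) s R = 0 → s.im = 0 ∧ s.re < 0)
    [IsCMField (cmField R)] {p : ℕ} (hp : 0 < p) (δ : cmNormResidueGroup R) :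
    ∃ (A : AbelianVariety ℂ) (η : A ⟶ A) (h : complexBetti A.X 2),
      IsOfCMType A ∧ IsWeilTypeCM A η R ℓ p ∧ IsPolarizationClass A.dim A.X h ∧ RosatiCompatible A η h ∧
      HasWeilDiscriminantCM A η R ℓ p h δ ∧ HodgeConjectureFor A.dim A.X ∧
      weilClassesField A η (R.comp (X ^ 2)) (2 * p) ≤ algebraicClasses A.X p := by
  obtain ⟨b₀, -, hb₀, hsep, he, hR, haev, hdegQ⟩ := carrier_presentation R hRm hRdeg hroots
  have h2ℓ : Module.finrank ℚ (cmField R) = 2 * ℓ := by rw [finrank_cmField, hRdeg]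
  by_cases hG : IsGalois ℚ (cmField R)
  · exact exists_cmMember_hodgeConjectureFor_of_finrank_eq_two_mul_prime (cmField R) hℓ hℓ2 h2ℓ hb₀ hsep he hRm hRdeg
      hR Fact.out hroots haev hdegQ hp δ
  · exact exists_cmMember_hodgeConjectureFor_of_not_isGalois_of_prime (cmField R) hG hℓ h2ℓ hb₀ hsep he hRm hRdeg hR
      Fact.out hroots haev hdegQ hp δ

end Carrier

end Summit.HodgeConjecture.HodgeConjecture.Ring2.WeilCoverageCM

end
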